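import Mathlib
import HarnessLib
import Summits.NavierStokesRegularity.NavierStokesRegularity.Theorems.UnthreadedRigidityDoorUnthreadedRigidityVirialHornDefs
import Summits.NavierStokesRegularity.NavierStokesRegularity.Theorems.UnthreadedRigidityDoorUnthreadedRigidityThreadingJetsWindowGeneric

/-!
# Route `UnthreadedRigidityDoor`, wall item W2 `UnthreadedRigidity` (stmt-NavierStokesRegularity-27585) — LINE g12-2 «PERSISTENCE FILTER»
# (ns-idea-6 g12, `Persistence_sketch.lean` 09bc8f71301208c4; idea-crit-7 g8 PASS; DIRECTOR-NS #294): support S «NO ADMISSIBLE CUBIC PROFILE»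
# `CubicLawNonexistence`, VERBATIM

Seat ns-es-p1 g8 (W2 second queue; announce-before-propose on the ideators bus).

* `cubicLawNonexistence` — **`CubicLawNonexistence` VERBATIM**: a virial-admissible profile `H` (`l = 2`), real-analytic on `(0,∞)`, with `K³ = C·H`
  there (`K = K_2[H] = H″ + 6H′/r`), vanishes on `(0,∞)`.

PROOF (CARD §3.6 for `C < 0`; an energy variant for `C > 0`).  Put `E := H′²/2 − 3K⁴/(4C)` (`C ≠ 0`).  From `H = K³/C`: `H′ = 3K²K′/C`, so
`E′ = H′H″ − K H′ = −6H′²/r ≤ 0` and `(r¹²E)′ = −9r¹¹K⁴/C` (`hasDerivAt_energy`, `hasDerivAt_weightedEnergy`).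
* `C = 0`: `K ≡ 0`, and the tree's `…ThreadingJets.eq_zero_of_vortAmpL_eq_zero` gives `H ≡ 0`.
* `C > 0` (`cubicLaw_pos_case`): `E` is non-increasing and tends to `≥ 0` at infinity (decay `|K| ≤ 7C₁r⁻⁶`), so `E ≥ 0`; `r¹²E` is non-increasing
  and `s¹²E(s) ≤ s¹²H′(s)²/2 → 0` as `s → 0⁺` (`H′(s) = 2s h′(s²)` is bounded near `0`), so `E ≤ 0`.  Hence `E ≡ 0`, `E′ ≡ 0`, `H′ ≡ 0`, `K ≡ 0`,
  `H = K³/C ≡ 0`.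
* `C = −c < 0` (`cubicLaw_neg_case`): `r¹²E` is non-decreasing; if `H(r₀) ≠ 0` then `e₁ := r₀¹²E(r₀) > 0` and `ξ¹²E(ξ) ≥ e₁` for `ξ ≥ r₀`.  Decay:
  `|K| ≤ M r⁻⁶` (`M = 7C₁`), `|H| = |K|³/c ≤ M³/(c r¹⁸)` on `[1,∞)`.  For `R ≥ max(r₀,1)` the mean value theorem on `[R, 2R]` gives `ξ` with
  `H′(ξ)² = (H(2R) − H(R))²/R² ≤ 4M⁶/(c²R³⁸)`, whence `ξ¹²E(ξ) ≤ 4096·A/R` with `A = 3M⁴/(4c) + 2M⁶/c²`; `R > 4096A/e₁` is absurd.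

HONEST LABEL: an elementary ODE support of a files-only rung line; nothing here bears on `UnthreadedRigidity` (27585), the door Target, W2 or Navier–Stokes
regularity; no summit statement is proved.  MODEL/rung work.
-/

noncomputable section

-- the summit and its single sub-problem share the name (CONVENTIONS §1), as in every Theorems file
set_option linter.dupNamespace false

namespace Summit.NavierStokesRegularity.NavierStokesRegularity.Theorems.UnthreadedRigidity.Persistence

open Set Function Filter Topology
open Summit.NavierStokesRegularity.NavierStokesRegularity.Theorems.UnthreadedRigidity.VirialHorn (VirialAdmissible vortAmpL strainAmpL)
open Summit.NavierStokesRegularity.NavierStokesRegularity.Theorems.UnthreadedRigidity.ThreadingJets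
  (virialAdmissible_hasDerivAt_of_pos eq_zero_of_vortAmpL_eq_zero analyticOnNhd_vortAmpL)

/-! ## Decay of the vorticity amplitude -/

/-- Decay of an `l = 2` virial-admissible profile on `[1,∞)`: `|H′| ≤ M r⁻⁵` and `|K_2[H]| ≤ M r⁻⁶` with `M = 7C₁ ≥ 0`. -/
theorem decay_vortAmpL_two {H : ℝ → ℝ} (hH : VirialAdmissible 2 H) :
    ∃ M : ℝ, 0 ≤ M ∧ ∀ r : ℝ, 1 ≤ r → |deriv H r| ≤ M / r ^ 5 ∧ |vortAmpL 2 H r| ≤ M / r ^ 6 := by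
  obtain ⟨C, hC⟩ := hH.2
  have hC0 : 0 ≤ C := by
    obtain ⟨h0, -, -⟩ := hC 1 le_rfl
    exact le_trans (by positivity) h0
  refine ⟨7 * C, by positivity, fun r hr => ?_⟩
  obtain ⟨-, h1, h2⟩ := hC r hr
  have hr0 : 0 < r := lt_of_lt_of_le one_pos hr
  have hH1 : |deriv H r| ≤ C / r ^ 5 := by
    rw [le_div_iff₀ (by positivity)]
    calc |deriv H r| * r ^ 5 = r ^ (2 + 3) * |deriv H r| := by ring
      _ ≤ C := h1
  have hH2 : |deriv (deriv H) r| ≤ C / r ^ 6 := by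
    rw [le_div_iff₀ (by positivity)]
    calc |deriv (deriv H) r| * r ^ 6 = r ^ (2 + 4) * |deriv (deriv H) r| := by ring
      _ ≤ C := h2
  refine ⟨?_, ?_⟩
  · calc |deriv H r| ≤ C / r ^ 5 := hH1
      _ ≤ 7 * C / r ^ 5 := by gcongr; linarith
  · unfold vortAmpL
    have e : 2 * (((2 : ℕ) : ℝ) + 1) / r * deriv H r = 6 / r * deriv H r := by push_cast; ring
    rw [e]
    calc |deriv (deriv H) r + 6 / r * deriv H r|
        ≤ |deriv (deriv H) r| + |6 / r * deriv H r| := abs_add_le _ _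
      _ = |deriv (deriv H) r| + 6 / r * |deriv H r| := by
          rw [abs_mul, abs_div, abs_of_pos hr0, abs_of_pos (by norm_num : (0 : ℝ) < 6)]
      _ ≤ C / r ^ 6 + 6 / r * (C / r ^ 5) := by gcongr
      _ = 7 * C / r ^ 6 := by field_simp; ring

/-! ## The energy `E = H′²/2 − 3K⁴/(4C)` -/

/-- `E′ = −6H′²/r` on `(0,∞)` when `K³ = C·H` (`C ≠ 0`). -/
theorem hasDerivAt_energy {H : ℝ → ℝ} (hHa : AnalyticOnNhd ℝ H (Ioi 0)) {C : ℝ} (hC : C ≠ 0)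
    (hKC : ∀ r : ℝ, 0 < r → vortAmpL 2 H r ^ 3 = C * H r) {r : ℝ} (hr : 0 < r) :
    HasDerivAt (fun s => deriv H s ^ 2 / 2 - 3 * vortAmpL 2 H s ^ 4 / (4 * C)) (-(6 * deriv H r ^ 2 / r)) r := by
  have hK : AnalyticOnNhd ℝ (vortAmpL 2 H) (Ioi 0) := analyticOnNhd_vortAmpL hHa
  have hH2 : HasDerivAt (deriv H) (deriv (deriv H) r) r := (hHa.deriv r hr).differentiableAt.hasDerivAt
  have hK1 : HasDerivAt (vortAmpL 2 H) (deriv (vortAmpL 2 H) r) r := (hK r hr).differentiableAt.hasDerivAt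
  -- `H′ = 3K²K′/C` from `H = K³/C` near `r`
  have hHK : H =ᶠ[𝓝 r] fun s => vortAmpL 2 H s ^ 3 / C := by
    filter_upwards [Ioi_mem_nhds hr] with s hs
    rw [hKC s hs]; field_simp
  have hK3 : HasDerivAt (fun s => vortAmpL 2 H s ^ 3 / C)
      (3 * vortAmpL 2 H r ^ 2 * deriv (vortAmpL 2 H) r / C) r :=
    ((hK1.fun_pow 3).div_const C).congr_deriv (by norm_num)
  have e1 : deriv H r = 3 * vortAmpL 2 H r ^ 2 * deriv (vortAmpL 2 H) r / C := by
    rw [hHK.deriv_eq]; exact hK3.deriv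
  -- `K = H″ + 6H′/r`
  have e2 : vortAmpL 2 H r = deriv (deriv H) r + 6 * deriv H r / r := by
    unfold vortAmpL; push_cast; ring
  have e3 : 3 * vortAmpL 2 H r ^ 3 * deriv (vortAmpL 2 H) r / C = vortAmpL 2 H r * deriv H r := by
    rw [e1]; ring
  -- differentiate the two summands
  have hA : HasDerivAt (fun s => deriv H s ^ 2 / 2) (2 * deriv H r * deriv (deriv H) r / 2) r :=
    ((hH2.fun_pow 2).div_const 2).congr_deriv (by norm_num)
  have hB : HasDerivAt (fun s => 3 * vortAmpL 2 H s ^ 4 / (4 * C))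
      (3 * (4 * vortAmpL 2 H r ^ 3 * deriv (vortAmpL 2 H) r) / (4 * C)) r :=
    (((hK1.fun_pow 4).const_mul 3).div_const (4 * C)).congr_deriv (by norm_num)
  refine (hA.sub hB).congr_deriv ?_
  linear_combination (-1 : ℝ) * e3 + (-(deriv H r)) * e2

/-- `(r¹²E)′ = −9r¹¹K⁴/C` on `(0,∞)` when `K³ = C·H` (`C ≠ 0`). -/
theorem hasDerivAt_weightedEnergy {H : ℝ → ℝ} (hHa : AnalyticOnNhd ℝ H (Ioi 0)) {C : ℝ} (hC : C ≠ 0)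
    (hKC : ∀ r : ℝ, 0 < r → vortAmpL 2 H r ^ 3 = C * H r) {r : ℝ} (hr : 0 < r) :
    HasDerivAt (fun s => s ^ 12 * (deriv H s ^ 2 / 2 - 3 * vortAmpL 2 H s ^ 4 / (4 * C)))
      (-(9 * r ^ 11 * vortAmpL 2 H r ^ 4 / C)) r := by
  have h1 : HasDerivAt (fun s : ℝ => s ^ 12) (((12 : ℕ) : ℝ) * r ^ 11) r := by
    simpa using hasDerivAt_pow 12 r
  have hr' : r ≠ 0 := hr.ne'
  refine (h1.mul (hasDerivAt_energy hHa hC hKC hr)).congr_deriv ?_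
  push_cast
  field_simp
  ring

/-- **No admissible cubic profile with `C > 0`** (energy variant). -/
theorem cubicLaw_pos_case {H : ℝ → ℝ} (hH : VirialAdmissible 2 H) (hHa : AnalyticOnNhd ℝ H (Ioi 0)) {C : ℝ}
    (hC : 0 < C) (hKC : ∀ r : ℝ, 0 < r → vortAmpL 2 H r ^ 3 = C * H r) : ∀ r : ℝ, 0 < r → H r = 0 := by
  set E : ℝ → ℝ := fun s => deriv H s ^ 2 / 2 - 3 * vortAmpL 2 H s ^ 4 / (4 * C) with hE
  have hEd : ∀ r, 0 < r → HasDerivAt E (-(6 * deriv H r ^ 2 / r)) r := fun r hr =>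
    hasDerivAt_energy hHa hC.ne' hKC hr
  have hWd : ∀ r, 0 < r → HasDerivAt (fun s => s ^ 12 * E s) (-(9 * r ^ 11 * vortAmpL 2 H r ^ 4 / C)) r :=
    fun r hr => hasDerivAt_weightedEnergy hHa hC.ne' hKC hr
  -- `E` and `r¹²E` are non-increasing on `(0,∞)`
  have hEanti : AntitoneOn E (Ioi 0) := by
    apply antitoneOn_of_deriv_nonpos (convex_Ioi 0)
    · exact fun r hr => (hEd r hr).continuousAt.continuousWithinAt
    · rw [interior_Ioi]; exact fun r hr => (hEd r hr).differentiableAt.differentiableWithinAt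
    · rw [interior_Ioi]; intro r hr
      have hr' : 0 < r := hr
      rw [(hEd r hr').deriv]
      have : 0 ≤ 6 * deriv H r ^ 2 / r := by positivity
      linarith
  have hWanti : AntitoneOn (fun s => s ^ 12 * E s) (Ioi 0) := by
    apply antitoneOn_of_deriv_nonpos (convex_Ioi 0)
    · exact fun r hr => (hWd r hr).continuousAt.continuousWithinAt
    · rw [interior_Ioi]; exact fun r hr => (hWd r hr).differentiableAt.differentiableWithinAt
    · rw [interior_Ioi]; intro r hr
      have hr' : 0 < r := hr
      rw [(hWd r hr').deriv]
      have : 0 ≤ 9 * r ^ 11 * vortAmpL 2 H r ^ 4 / C := by positivity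
      linarith
  obtain ⟨M, hM0, hM⟩ := decay_vortAmpL_two hH
  -- `E ≥ 0`: let `s → ∞` in `E r ≥ E s ≥ −3K(s)⁴/(4C) ≥ −(3M⁴/(4C))/s`
  have hEnn : ∀ r, 0 < r → 0 ≤ E r := by
    intro r hr
    have hlim : Tendsto (fun s : ℝ => -(3 * M ^ 4 / (4 * C)) / s) atTop (𝓝 0) :=
      tendsto_const_nhds.div_atTop tendsto_id
    refine le_of_tendsto_of_tendsto hlim tendsto_const_nhds ?_
    filter_upwards [eventually_ge_atTop (max r 1)] with s hs
    have hs1 : 1 ≤ s := le_trans (le_max_right _ _) hs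
    have hrs : r ≤ s := le_trans (le_max_left _ _) hs
    have hs0 : 0 < s := lt_of_lt_of_le one_pos hs1
    have h1 : E s ≤ E r := hEanti (mem_Ioi.2 hr) (mem_Ioi.2 hs0) hrs
    have hK4 : vortAmpL 2 H s ^ 4 ≤ M ^ 4 / s := by
      have hKs := (hM s hs1).2
      calc vortAmpL 2 H s ^ 4 = |vortAmpL 2 H s| ^ 4 := by rw [Even.pow_abs (by decide)]
        _ ≤ (M / s ^ 6) ^ 4 := pow_le_pow_left₀ (abs_nonneg _) hKs 4
        _ = M ^ 4 / s ^ 24 := by rw [div_pow, ← pow_mul]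
        _ ≤ M ^ 4 / s := by
            apply div_le_div_of_nonneg_left (by positivity) hs0
            calc s = s ^ 1 := (pow_one s).symm
              _ ≤ s ^ 24 := pow_le_pow_right₀ hs1 (by norm_num)
    have h2 : -(3 * M ^ 4 / (4 * C)) / s ≤ E s := by
      have h3 : 3 * vortAmpL 2 H s ^ 4 / (4 * C) ≤ 3 * (M ^ 4 / s) / (4 * C) := by gcongr
      have h4 : 0 ≤ deriv H s ^ 2 / 2 := by positivity
      have h5 : -(3 * M ^ 4 / (4 * C)) / s = -(3 * (M ^ 4 / s) / (4 * C)) := by ring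
      rw [h5]
      show -(3 * (M ^ 4 / s) / (4 * C)) ≤ deriv H s ^ 2 / 2 - 3 * vortAmpL 2 H s ^ 4 / (4 * C)
      linarith
    exact h2.trans h1
  -- `E ≤ 0`: let `s → 0⁺` in `r¹²E r ≤ s¹²E s ≤ s¹²·B²/2`
  obtain ⟨h, hh, -, hder⟩ := virialAdmissible_hasDerivAt_of_pos hH
  have hEnp : ∀ r, 0 < r → E r ≤ 0 := by
    intro r hr
    have hcont : ContinuousOn (fun s : ℝ => 2 * s * deriv h (s ^ 2)) (Icc 0 r) := by
      have h1 : ContDiff ℝ (⊤ : ℕ∞) (deriv h) := hh.deriv'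
      exact ((continuous_const.mul continuous_id).mul (h1.continuous.comp (continuous_pow 2))).continuousOn
    obtain ⟨B, hB⟩ := isCompact_Icc.exists_bound_of_continuousOn hcont
    have hkey : ∀ s, 0 < s → s ≤ r → r ^ 12 * E r ≤ B ^ 2 / 2 * s ^ 12 := by
      intro s hs hsr
      have h1 : r ^ 12 * E r ≤ s ^ 12 * E s := hWanti (mem_Ioi.2 hs) (mem_Ioi.2 hr) hsr
      have h2 : E s ≤ B ^ 2 / 2 := by
        have h3 : |deriv H s| ≤ B := by
          have h4 := hB s ⟨hs.le, hsr⟩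
          rw [Real.norm_eq_abs] at h4
          rwa [(hder s hs).deriv]
        have h4 : deriv H s ^ 2 ≤ B ^ 2 := by
          rw [← sq_abs]; exact pow_le_pow_left₀ (abs_nonneg _) h3 2
        have h5 : 0 ≤ 3 * vortAmpL 2 H s ^ 4 / (4 * C) := by positivity
        show deriv H s ^ 2 / 2 - 3 * vortAmpL 2 H s ^ 4 / (4 * C) ≤ B ^ 2 / 2
        linarith
      calc r ^ 12 * E r ≤ s ^ 12 * E s := h1
        _ ≤ s ^ 12 * (B ^ 2 / 2) := by gcongr
        _ = B ^ 2 / 2 * s ^ 12 := by ring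
    have hlim : Tendsto (fun s : ℝ => B ^ 2 / 2 * s ^ 12) (𝓝[>] 0) (𝓝 0) := by
      have hc : Continuous fun s : ℝ => B ^ 2 / 2 * s ^ 12 := continuous_const.mul (continuous_pow 12)
      have h1 := hc.tendsto 0
      rw [zero_pow (by norm_num), mul_zero] at h1
      exact h1.mono_left nhdsWithin_le_nhds
    have h1 : r ^ 12 * E r ≤ 0 := by
      refine le_of_tendsto_of_tendsto tendsto_const_nhds hlim ?_
      filter_upwards [Ioo_mem_nhdsGT hr] with s hs
      exact hkey s hs.1 hs.2.le
    by_contra h3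
    push Not at h3
    have : 0 < r ^ 12 * E r := mul_pos (by positivity) h3
    linarith
  -- `E ≡ 0`, hence `H′ ≡ 0`, `K ≡ 0`, `H ≡ 0`
  have hE0 : ∀ r, 0 < r → E r = 0 := fun r hr => le_antisymm (hEnp r hr) (hEnn r hr)
  intro r hr
  have hE0' : E =ᶠ[𝓝 r] fun _ => (0 : ℝ) := by
    filter_upwards [Ioi_mem_nhds hr] with s hs
    exact hE0 s hs
  have hd : -(6 * deriv H r ^ 2 / r) = 0 := by
    rw [← (hEd r hr).deriv, hE0'.deriv_eq, deriv_const]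
  have hH1 : deriv H r = 0 := by
    have h1 : 6 * deriv H r ^ 2 / r = 0 := by linarith
    rcases div_eq_zero_iff.1 h1 with h2 | h2
    · exact (pow_eq_zero_iff two_ne_zero).1 ((mul_eq_zero.1 h2).resolve_left (by norm_num))
    · exact absurd h2 hr.ne'
  have hK0 : vortAmpL 2 H r = 0 := by
    have h1 : 3 * vortAmpL 2 H r ^ 4 / (4 * C) = 0 := by
      have h2 := hE0 r hr
      have h3 : E r = deriv H r ^ 2 / 2 - 3 * vortAmpL 2 H r ^ 4 / (4 * C) := rfl
      rw [h3, hH1] at h2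
      linarith
    rcases div_eq_zero_iff.1 h1 with h2 | h2
    · exact (pow_eq_zero_iff (by norm_num)).1 ((mul_eq_zero.1 h2).resolve_left (by norm_num))
    · exact absurd h2 (by positivity)
  have h1 := hKC r hr
  rw [hK0] at h1
  have h2 : C * H r = 0 := by rw [← h1]; norm_num
  exact (mul_eq_zero.1 h2).resolve_left hC.ne'

/-- **No admissible cubic profile with `C = −c < 0`** (CARD §3.6). -/
theorem cubicLaw_neg_case {H : ℝ → ℝ} (hH : VirialAdmissible 2 H) (hHa : AnalyticOnNhd ℝ H (Ioi 0)) {c : ℝ}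
    (hc : 0 < c) (hKC : ∀ r : ℝ, 0 < r → vortAmpL 2 H r ^ 3 = -c * H r) : ∀ r : ℝ, 0 < r → H r = 0 := by
  set E : ℝ → ℝ := fun s => deriv H s ^ 2 / 2 - 3 * vortAmpL 2 H s ^ 4 / (4 * -c) with hE
  have hc' : -c ≠ 0 := neg_ne_zero.2 hc.ne'
  have hWd : ∀ r, 0 < r → HasDerivAt (fun s => s ^ 12 * E s) (-(9 * r ^ 11 * vortAmpL 2 H r ^ 4 / -c)) r :=
    fun r hr => hasDerivAt_weightedEnergy hHa hc' hKC hr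
  -- `r¹²E` is non-decreasing on `(0,∞)`
  have hWmono : MonotoneOn (fun s => s ^ 12 * E s) (Ioi 0) := by
    apply monotoneOn_of_deriv_nonneg (convex_Ioi 0)
    · exact fun r hr => (hWd r hr).continuousAt.continuousWithinAt
    · rw [interior_Ioi]; exact fun r hr => (hWd r hr).differentiableAt.differentiableWithinAt
    · rw [interior_Ioi]; intro r hr
      have hr' : 0 < r := hr
      rw [(hWd r hr').deriv, div_neg, neg_neg]
      positivity
  by_contra hne
  push Not at hne
  obtain ⟨r₀, hr₀, hH0⟩ := hne
  have hK0 : vortAmpL 2 H r₀ ≠ 0 := by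
    intro h0
    have h1 := hKC r₀ hr₀
    rw [h0] at h1
    have h2 : -c * H r₀ = 0 := by rw [← h1]; norm_num
    exact hH0 ((mul_eq_zero.1 h2).resolve_left hc')
  -- `e₁ = r₀¹² E(r₀) > 0`
  have hEr₀ : E r₀ = deriv H r₀ ^ 2 / 2 + 3 * vortAmpL 2 H r₀ ^ 4 / (4 * c) := by
    show deriv H r₀ ^ 2 / 2 - 3 * vortAmpL 2 H r₀ ^ 4 / (4 * -c) = _
    field_simp
    ring
  have he1 : 0 < r₀ ^ 12 * E r₀ := by
    have h1 : 0 < E r₀ := by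
      rw [hEr₀]
      have h2 : 0 < vortAmpL 2 H r₀ ^ 4 := by positivity
      have h3 : 0 ≤ deriv H r₀ ^ 2 / 2 := by positivity
      have h4 : 0 < 3 * vortAmpL 2 H r₀ ^ 4 / (4 * c) := by positivity
      linarith
    positivity
  obtain ⟨e₁, he₁⟩ : ∃ e : ℝ, e = r₀ ^ 12 * E r₀ := ⟨_, rfl⟩
  have he1' : 0 < e₁ := he₁ ▸ he1
  -- decay: `|K| ≤ M/s⁶`, `|H| ≤ M³/(c s¹⁸)` on `[1,∞)`
  obtain ⟨M, hM0, hM⟩ := decay_vortAmpL_two hH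
  have hHdec : ∀ s, 1 ≤ s → |H s| ≤ M ^ 3 / (c * s ^ 18) := by
    intro s hs
    have hs0 : 0 < s := lt_of_lt_of_le one_pos hs
    have h1 : H s = -(vortAmpL 2 H s ^ 3) / c := by
      have h2 := hKC s hs0
      field_simp
      linarith
    have h2 : |vortAmpL 2 H s| ^ 3 ≤ (M / s ^ 6) ^ 3 := pow_le_pow_left₀ (abs_nonneg _) (hM s hs).2 3
    rw [h1, abs_div, abs_neg, abs_pow, abs_of_pos hc]
    calc |vortAmpL 2 H s| ^ 3 / c ≤ (M / s ^ 6) ^ 3 / c := by gcongr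
      _ = M ^ 3 / (c * s ^ 18) := by rw [div_pow, ← pow_mul]; field_simp
  -- the radius `R`
  obtain ⟨A, hA⟩ : ∃ A : ℝ, A = 3 * M ^ 4 / (4 * c) + 2 * M ^ 6 / c ^ 2 := ⟨_, rfl⟩
  have hA0 : 0 ≤ A := by rw [hA]; positivity
  obtain ⟨R, hR⟩ : ∃ R : ℝ, R = max r₀ 1 + 4096 * A / e₁ + 1 := ⟨_, rfl⟩
  have hAe : 0 ≤ 4096 * A / e₁ := by positivity
  have hm1 := le_max_right r₀ 1
  have hm0 := le_max_left r₀ 1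
  have hR1 : 1 ≤ R := by rw [hR]; linarith only [hm1, hAe]
  have hRr₀ : r₀ ≤ R := by rw [hR]; linarith only [hm0, hAe]
  have hRA : 4096 * A / e₁ < R := by rw [hR]; linarith only [hm1, hAe]
  have hR0 : 0 < R := lt_of_lt_of_le one_pos hR1
  -- mean value theorem on `[R, 2R]`
  have hcont : ContinuousOn H (Icc R (2 * R)) :=
    hHa.continuousOn.mono fun s hs => lt_of_lt_of_le hR0 hs.1
  have hdiff : DifferentiableOn ℝ H (Ioo R (2 * R)) :=
    hHa.differentiableOn.mono fun s hs => lt_trans hR0 hs.1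
  obtain ⟨ξ, hξ, hξd⟩ := exists_deriv_eq_slope H (by linarith only [hR0] : R < 2 * R) hcont hdiff
  have hξR : R ≤ ξ := hξ.1.le
  have hξ2R : ξ ≤ 2 * R := hξ.2.le
  have hξ1 : 1 ≤ ξ := hR1.trans hξR
  have hξ0 : 0 < ξ := lt_of_lt_of_le one_pos hξ1
  have hξr₀ : r₀ ≤ ξ := hRr₀.trans hξR
  -- lower bound at `ξ`
  have hlow : e₁ ≤ ξ ^ 12 * E ξ := he₁ ▸ hWmono (mem_Ioi.2 hr₀) (mem_Ioi.2 hξ0) hξr₀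
  -- upper bounds at `ξ`
  have hH' : deriv H ξ ^ 2 ≤ 4 * M ^ 6 / (c ^ 2 * R ^ 38) := by
    rw [hξd]
    have h1 : |H (2 * R) - H R| ≤ 2 * (M ^ 3 / (c * R ^ 18)) := by
      have h2 := hHdec R hR1
      have h3 := hHdec (2 * R) (by linarith only [hR1])
      have h4 : M ^ 3 / (c * (2 * R) ^ 18) ≤ M ^ 3 / (c * R ^ 18) := by
        apply div_le_div_of_nonneg_left (by positivity) (by positivity)
        gcongr; linarith only [hR0]
      calc |H (2 * R) - H R| ≤ |H (2 * R)| + |H R| := abs_sub _ _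
        _ ≤ 2 * (M ^ 3 / (c * R ^ 18)) := by linarith only [h2, h3, h4]
    have h5 : (H (2 * R) - H R) ^ 2 ≤ (2 * (M ^ 3 / (c * R ^ 18))) ^ 2 := by
      rw [← sq_abs]; exact pow_le_pow_left₀ (abs_nonneg _) h1 2
    have h6 : 2 * R - R = R := by ring
    rw [h6, div_pow, div_le_iff₀ (by positivity)]
    calc (H (2 * R) - H R) ^ 2 ≤ (2 * (M ^ 3 / (c * R ^ 18))) ^ 2 := h5
      _ = 4 * M ^ 6 / (c ^ 2 * R ^ 38) * R ^ 2 := by field_simp; ring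
  have hK4 : vortAmpL 2 H ξ ^ 4 ≤ M ^ 4 / ξ ^ 24 := by
    calc vortAmpL 2 H ξ ^ 4 = |vortAmpL 2 H ξ| ^ 4 := by rw [Even.pow_abs (by decide)]
      _ ≤ (M / ξ ^ 6) ^ 4 := pow_le_pow_left₀ (abs_nonneg _) (hM ξ hξ1).2 4
      _ = M ^ 4 / ξ ^ 24 := by rw [div_pow, ← pow_mul]
  have hup : ξ ^ 12 * E ξ ≤ 4096 * A / R := by
    have t1 : ξ ^ 12 * (deriv H ξ ^ 2 / 2) ≤ (2 * R) ^ 12 * (4 * M ^ 6 / (c ^ 2 * R ^ 38) / 2) := by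
      calc ξ ^ 12 * (deriv H ξ ^ 2 / 2) ≤ (2 * R) ^ 12 * (deriv H ξ ^ 2 / 2) := by gcongr
        _ ≤ (2 * R) ^ 12 * (4 * M ^ 6 / (c ^ 2 * R ^ 38) / 2) := by gcongr
    have t2 : ξ ^ 12 * (3 * vortAmpL 2 H ξ ^ 4 / (4 * c)) ≤ ξ ^ 12 * (3 * (M ^ 4 / ξ ^ 24) / (4 * c)) := by
      gcongr
    have t3 : ξ ^ 12 * (3 * (M ^ 4 / ξ ^ 24) / (4 * c)) = 3 * M ^ 4 / (4 * c) / ξ ^ 12 := by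
      field_simp
    have t4 : 3 * M ^ 4 / (4 * c) / ξ ^ 12 ≤ 3 * M ^ 4 / (4 * c) / R := by
      apply div_le_div_of_nonneg_left (by positivity) hR0
      calc R ≤ ξ := hξR
        _ = ξ ^ 1 := (pow_one ξ).symm
        _ ≤ ξ ^ 12 := pow_le_pow_right₀ hξ1 (by norm_num)
    have t5 : (2 * R) ^ 12 * (4 * M ^ 6 / (c ^ 2 * R ^ 38) / 2) = 4096 * (2 * M ^ 6 / c ^ 2) / R ^ 26 := by
      field_simp; ring
    have t6 : 4096 * (2 * M ^ 6 / c ^ 2) / R ^ 26 ≤ 4096 * (2 * M ^ 6 / c ^ 2) / R := by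
      apply div_le_div_of_nonneg_left (by positivity) hR0
      calc R = R ^ 1 := (pow_one R).symm
        _ ≤ R ^ 26 := pow_le_pow_right₀ hR1 (by norm_num)
    have t7 : 3 * M ^ 4 / (4 * c) / R ≤ 4096 * (3 * M ^ 4 / (4 * c)) / R := by
      rw [div_le_div_iff_of_pos_right hR0]
      have : 0 ≤ 3 * M ^ 4 / (4 * c) := by positivity
      linarith only [this]
    have expand : ξ ^ 12 * E ξ = ξ ^ 12 * (deriv H ξ ^ 2 / 2) + ξ ^ 12 * (3 * vortAmpL 2 H ξ ^ 4 / (4 * c)) := by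
      show ξ ^ 12 * (deriv H ξ ^ 2 / 2 - 3 * vortAmpL 2 H ξ ^ 4 / (4 * -c)) = _
      field_simp
      ring
    have hAexp : 4096 * A / R = 4096 * (3 * M ^ 4 / (4 * c)) / R + 4096 * (2 * M ^ 6 / c ^ 2) / R := by
      rw [hA]; ring
    rw [expand, hAexp]
    linarith only [t1, t2, t3, t4, t5, t6, t7]
  -- contradiction
  have hfin : 4096 * A / R < e₁ := by
    rw [div_lt_iff₀ hR0]
    have h1 := hRA
    rw [div_lt_iff₀ he1'] at h1
    linarith only [h1]
  linarith only [hlow, hup, hfin]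

/-- **`CubicLawNonexistence` (VERBATIM)**: a virial-admissible (`l = 2`) profile, real-analytic on `(0,∞)`, with `K_2[H]³ = C·H` there vanishes on
`(0,∞)` (module docstring for the proof). -/
theorem cubicLawNonexistence :
    ∀ (H : ℝ → ℝ), VirialAdmissible 2 H → AnalyticOnNhd ℝ H (Set.Ioi 0) →
      (∃ C : ℝ, ∀ r : ℝ, 0 < r → vortAmpL 2 H r ^ 3 = C * H r) → ∀ r : ℝ, 0 < r → H r = 0 := by
  intro H hH hHa hC
  obtain ⟨C, hKC⟩ := hC
  rcases lt_trichotomy C 0 with hC0 | hC0 | hC0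
  · exact cubicLaw_neg_case hH hHa (c := -C) (by linarith) (fun r hr => by rw [neg_neg]; exact hKC r hr)
  · subst hC0
    have hK : ∀ r : ℝ, 0 < r → vortAmpL 2 H r = 0 := fun r hr => by
      have h1 := hKC r hr
      rw [zero_mul] at h1
      exact (pow_eq_zero_iff (by norm_num)).1 h1
    exact fun r hr => (eq_zero_of_vortAmpL_eq_zero hH hK r hr).1
  · exact cubicLaw_pos_case hH hHa hC0 hKC

end Summit.NavierStokesRegularity.NavierStokesRegularity.Theorems.UnthreadedRigidity.Persistence

end
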